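import Literature.Probability.RandomMatrix.UnitaryInvariantPolar
import Literature.Computability.QuantumComplexity.HaarUnitaryHidingProofs
import HarnessLib

/-!
# The law of the first coordinates of a uniformly random point on a complex sphere

For independent standard complex Gaussian vectors `z ∈ ℂⁿ`, `y ∈ ℂᵉ` (`n, e ≥ 1`; laws `γⁿ = gaussianPi`,
so that `(z, y)/‖(z, y)‖` is uniformly distributed on the unit sphere of `ℂ^{n+e} ≅ ℝ^{2(n+e)}`),
the block of the first `n` coordinates of the unit vector,

  `w = sphereHead (z, y) = z / √(|z|² + |y|²) ∈ ℂⁿ`,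

has the absolutely continuous law

  `C · (1 − |w|²)^{e−1} 𝟙[|w| < 1] dw`     (`map_sphereHead_gaussianPi_prod`)

with respect to Lebesgue measure on `ℂⁿ` (`volume` on `Fin n → ℂ`), for a constant
`C = sphereHeadConst n e ∈ (0, ∞)` (`sphereHeadConst_ne_zero_and_ne_top`; classically
`C = π^{-n} (n+e−1)!/(e−1)!`, which is not needed and not evaluated). This is the one-column
("rank one") case of the density `∝ det(1 − A*A)^{m−2n}` of an `n × n` truncation of a Haar unitary
of size `m` (Petz–Réffy; Aaronson–Arkhipov 2013, eq. (5.5)), and the analytic input of its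
column-by-column derivation.

## Proof

Only scalings and one radial substitution are used (no multivariate Jacobian):

1. (`lintegral_indicator_sphereHead`) for fixed `y ≠ 0` substitute `z = |y| v` in the `z`-integral
   (Lebesgue measure on `ℂⁿ ≅ ℝ^{2n}` scales by `|y|^{2n}`, `Measure.map_addHaar_smul`):
   `sphereHead (|y|v, y) = v/√(1+|v|²)`;
2. (`lintegral_moment_scaled`) after Tonelli, substitute `y = u/√(1+|v|²)` in the `y`-integral:
   `∫ |y|^{2n} e^{−|y|²(1+|v|²)} dy = (1+|v|²)^{−(n+e)} K₀`; hence the law of `w` is the image of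
   `C (1+|v|²)^{−(n+e)} dv` under the radial contraction `v ↦ v/√(1+|v|²)`;
3. (`lintegral_indicator_univUnitBall`) in polar coordinates on the real normed space
   `EuclideanSpace ℂ (Fin n)` (Mathlib's `measurePreserving_homeomorphUnitSphereProd`, unfolded in
   `lintegral_eq_lintegral_sphere_lintegral_Ioi`) the contraction (Mathlib's
   `OpenPartialHomeomorph.univUnitBall`) acts on the radius only, by
   `ρ(r) = r/√(1+r²)`, and the one-dimensional substitution `t = ρ(r)`
   (`lintegral_Ioo_eq_lintegral_Ioi_rho`, via `lintegral_image_eq_lintegral_deriv_mul_of_monotoneOn`)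
   turns `(1+r²)^{−(n+e)} r^{2n−1} dr` into `(1−t²)^{e−1} t^{2n−1} dt` on `(0,1)`
   (`rho'_mul_pow_mul_ballProfile`).

Also recorded: the density `π^{-|ι|}e^{−∑|vᵢ|²}` of `γ^ι` (`gaussianPi_eq_withDensity`) and the
rescaling identity `∫ K = r^{2|ι|} ∫ K(r ·)` on `ι → ℂ` (`lintegral_eq_pow_mul_lintegral_smul`).

## References

Standard. E.g. the real case (first `k` coordinates of a uniform point on `S^{N−1}` have density
`∝ (1 − |w|²)^{(N−k)/2−1}`) is in R. J. Muirhead, *Aspects of multivariate statistical theory*,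
Wiley 1982, Thm. 1.5.6–1.5.7; the complex case `N = 2(n+e)`, `k = 2n` is the statement here. It
is used by D. Petz, J. Réffy, *On asymptotics of large Haar distributed unitary matrices*, Period.
Math. Hungar. 49 (2004) 103–117, and S. Aaronson, A. Arkhipov, *The computational complexity of
linear optics*, Theory of Computing 9 (2013) 143–252, §5.1.
-/

open MeasureTheory ProbabilityTheory Complex WithLp Real Set Metric
open scoped ENNReal NNReal

namespace Literature.Probability.RandomMatrix

/-! ### Polar integration on a finite-dimensional real normed space -/

section Polar

variable {E : Type*} [NormedAddCommGroup E] [NormedSpace ℝ E] [MeasurableSpace E] [BorelSpace E]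
  [FiniteDimensional ℝ E] [Nontrivial E] (μ : Measure E) [μ.IsAddHaarMeasure]

/-- Integration against Mathlib's radial measure `volumeIoiPow k` (density `r^k` on `(0,∞)`) is
integration over `(0, ∞)` with the weight `r^k`. [folklore] -/
theorem lintegral_volumeIoiPow (k : ℕ) (K : ℝ → ℝ≥0∞) (hK : Measurable K) :
    ∫⁻ r, K r.1 ∂(Measure.volumeIoiPow k) = ∫⁻ r in Ioi (0 : ℝ), ENNReal.ofReal (r ^ k) * K r := by
  have hf : Measurable fun r : Ioi (0 : ℝ) => ENNReal.ofReal (r.1 ^ k) := by fun_prop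
  have hg : Measurable fun r : Ioi (0 : ℝ) => K r.1 := hK.comp measurable_subtype_coe
  rw [Measure.volumeIoiPow, lintegral_withDensity_eq_lintegral_mul _ hf hg]
  have := setLIntegral_subtype (μ := (volume : Measure ℝ)) (measurableSet_Ioi (a := (0 : ℝ))) univ
    (fun r : ℝ => ENNReal.ofReal (r ^ k) * K r)
  rw [Measure.restrict_univ, image_univ, Subtype.range_coe] at this
  rw [← this]
  rfl

/-- **Integration in polar coordinates.** For an additive Haar measure `μ` on a nontrivial
finite-dimensional real normed space `E` and a measurable `H : E → [0,∞]`,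
`∫ H dμ = ∫_{θ ∈ S} ∫_{r > 0} r^{dim E − 1} H(r θ) dr dσ(θ)`, `σ = μ.toSphere` the induced measure
on the unit sphere (Mathlib's `measurePreserving_homeomorphUnitSphereProd`, unfolded to an
iterated integral). [folklore] -/
theorem lintegral_eq_lintegral_sphere_lintegral_Ioi (H : E → ℝ≥0∞) (hH : Measurable H) :
    ∫⁻ x, H x ∂μ =
      ∫⁻ θ : sphere (0 : E) 1, (∫⁻ r in Ioi (0 : ℝ),
        ENNReal.ofReal (r ^ (Module.finrank ℝ E - 1)) * H (r • (θ : E))) ∂μ.toSphere := by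
  -- remove the origin
  have h0 : ∫⁻ x, H x ∂μ = ∫⁻ x in ({0} : Set E)ᶜ, H x ∂μ := by
    rw [← lintegral_add_compl H (measurableSet_singleton (0 : E)),
      setLIntegral_measure_zero _ _ (measure_singleton 0), zero_add]
  -- pass to the subtype `{0}ᶜ`
  have hs : MeasurableSet (({0} : Set E)ᶜ) := (measurableSet_singleton 0).compl
  have h1 : ∫⁻ x in ({0} : Set E)ᶜ, H x ∂μ =
      ∫⁻ y : (({0} : Set E)ᶜ : Set E), H y ∂(μ.comap Subtype.val) := by
    have := setLIntegral_subtype (μ := μ) hs univ H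
    rw [Measure.restrict_univ, image_univ, Subtype.range_coe] at this
    exact this.symm
  -- polar homeomorphism
  set Φ := (homeomorphUnitSphereProd E).toMeasurableEquiv with hΦdef
  have hΦ : MeasurePreserving Φ (μ.comap Subtype.val)
      (μ.toSphere.prod (Measure.volumeIoiPow (Module.finrank ℝ E - 1))) := by
    have := μ.measurePreserving_homeomorphUnitSphereProd
    rwa [hΦdef, Homeomorph.toMeasurableEquiv_coe]
  have h2 : ∫⁻ y : (({0} : Set E)ᶜ : Set E), H y ∂(μ.comap Subtype.val) =
      ∫⁻ p, H ((p.2 : ℝ) • (p.1 : E))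
        ∂(μ.toSphere.prod (Measure.volumeIoiPow (Module.finrank ℝ E - 1))) := by
    rw [← hΦ.symm.map_eq, lintegral_map_equiv]
    refine lintegral_congr fun p => ?_
    rw [hΦdef, Homeomorph.toMeasurableEquiv_symm_coe, homeomorphUnitSphereProd_symm_apply_coe]
  have hHm : Measurable fun p : sphere (0 : E) 1 × Ioi (0 : ℝ) => H ((p.2 : ℝ) • (p.1 : E)) :=
    hH.comp ((measurable_subtype_coe.comp measurable_snd).smul
      (measurable_subtype_coe.comp measurable_fst))
  rw [h0, h1, h2, lintegral_prod _ hHm.aemeasurable]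
  refine lintegral_congr fun θ => ?_
  dsimp only
  exact lintegral_volumeIoiPow _ (fun r => H (r • (θ : E)))
    (hH.comp (measurable_id.smul measurable_const))

end Polar

/-! ### The radial substitution `t = r / √(1 + r²)` -/

/-- The radial profile change `ρ(r) = r / √(1 + r²)`, a bijection `(0, ∞) → (0, 1)`. [folklore] -/
noncomputable def rho (r : ℝ) : ℝ := r / Real.sqrt (1 + r ^ 2)

/-- Its derivative `ρ'(r) = (1 + r²)^{-3/2}`. [folklore] -/
noncomputable def rho' (r : ℝ) : ℝ := ((Real.sqrt (1 + r ^ 2))⁻¹) ^ 3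

/-- `√(1 + r²) > 0`. [folklore] -/
theorem sqrt_one_add_sq_pos (r : ℝ) : 0 < Real.sqrt (1 + r ^ 2) :=
  Real.sqrt_pos.2 (by positivity)

/-- `ρ` is differentiable with derivative `ρ'`. [folklore] -/
theorem hasDerivAt_rho (r : ℝ) : HasDerivAt rho (rho' r) r := by
  have hq : 0 < Real.sqrt (1 + r ^ 2) := sqrt_one_add_sq_pos r
  have h1 : HasDerivAt (fun r : ℝ => 1 + r ^ 2) (2 * r) r := by
    simpa using (hasDerivAt_pow 2 r).const_add 1
  have h2 : HasDerivAt (fun r : ℝ => Real.sqrt (1 + r ^ 2)) (2 * r / (2 * Real.sqrt (1 + r ^ 2))) r :=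
    h1.sqrt (by positivity : (0 : ℝ) < 1 + r ^ 2).ne'
  have h4 : HasDerivAt rho
      ((1 * Real.sqrt (1 + r ^ 2) - id r * (2 * r / (2 * Real.sqrt (1 + r ^ 2)))) /
        Real.sqrt (1 + r ^ 2) ^ 2) r :=
    (hasDerivAt_id r).div h2 hq.ne'
  convert h4 using 1
  have hq2 : Real.sqrt (1 + r ^ 2) ^ 2 = 1 + r ^ 2 := Real.sq_sqrt (by positivity : (0 : ℝ) < 1 + r ^ 2).le
  rw [rho', id]
  field_simp
  nlinarith [hq2]

/-- `ρ(r) > 0` for `r > 0`. [folklore] -/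
theorem rho_pos {r : ℝ} (hr : 0 < r) : 0 < rho r := div_pos hr (sqrt_one_add_sq_pos r)

/-- `ρ(r) < 1`. [folklore] -/
theorem rho_lt_one (r : ℝ) : rho r < 1 := by
  rw [rho, div_lt_one (sqrt_one_add_sq_pos r)]
  calc r ≤ |r| := le_abs_self r
    _ = Real.sqrt (r ^ 2) := (Real.sqrt_sq_eq_abs r).symm
    _ < Real.sqrt (1 + r ^ 2) := Real.sqrt_lt_sqrt (sq_nonneg r) (by linarith)

/-- `ρ(r)² = r²/(1+r²)`. [folklore] -/
theorem rho_sq (r : ℝ) : rho r ^ 2 = r ^ 2 / (1 + r ^ 2) := by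
  rw [rho, div_pow, Real.sq_sqrt (by positivity : (0 : ℝ) < 1 + r ^ 2).le]

/-- `1 − ρ(r)² = (1+r²)⁻¹`. [folklore] -/
theorem one_sub_rho_sq (r : ℝ) : 1 - rho r ^ 2 = (1 + r ^ 2)⁻¹ := by
  rw [rho_sq]; field_simp; ring

/-- `ρ` is increasing on `(0,∞)`. [folklore] -/
theorem monotoneOn_rho : MonotoneOn rho (Ioi 0) := by
  intro a ha b hb hab
  have ha0 : 0 < a := ha
  have hb0 : 0 < b := hb
  rw [rho, rho, div_le_div_iff₀ (sqrt_one_add_sq_pos a) (sqrt_one_add_sq_pos b)]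
  have h1 : a * Real.sqrt (1 + b ^ 2) = Real.sqrt (a ^ 2 * (1 + b ^ 2)) := by
    rw [Real.sqrt_mul (sq_nonneg a), Real.sqrt_sq ha0.le]
  have h2 : b * Real.sqrt (1 + a ^ 2) = Real.sqrt (b ^ 2 * (1 + a ^ 2)) := by
    rw [Real.sqrt_mul (sq_nonneg b), Real.sqrt_sq hb0.le]
  rw [h1, h2]
  refine Real.sqrt_le_sqrt ?_
  have : a ^ 2 ≤ b ^ 2 := pow_le_pow_left₀ ha0.le hab 2
  nlinarith

/-- `ρ` maps `(0,∞)` onto `(0,1)`. [folklore] -/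
theorem rho_image_Ioi : rho '' Ioi 0 = Ioo 0 1 := by
  ext t
  constructor
  · rintro ⟨r, hr, rfl⟩
    exact ⟨rho_pos hr, rho_lt_one r⟩
  · rintro ⟨ht0, ht1⟩
    refine ⟨t / Real.sqrt (1 - t ^ 2), div_pos ht0 (Real.sqrt_pos.2 (by nlinarith)), ?_⟩
    have h1t : 0 < 1 - t ^ 2 := by nlinarith
    rw [rho, div_pow, Real.sq_sqrt h1t.le]
    have : 1 + t ^ 2 / (1 - t ^ 2) = (1 - t ^ 2)⁻¹ := by field_simp; ring
    rw [this, Real.sqrt_inv, div_inv_eq_mul, div_mul_cancel₀ _ (Real.sqrt_pos.2 h1t).ne']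

/-- **Substitution `t = ρ(r)`** in a Lebesgue integral over `(0, 1)`:
`∫_{(0,1)} u(t) dt = ∫_{(0,∞)} ρ'(r) u(ρ(r)) dr`. [folklore] -/
theorem lintegral_Ioo_eq_lintegral_Ioi_rho (u : ℝ → ℝ≥0∞) :
    ∫⁻ t in Ioo (0 : ℝ) 1, u t = ∫⁻ r in Ioi (0 : ℝ), ENNReal.ofReal (rho' r) * u (rho r) := by
  rw [← rho_image_Ioi]
  exact lintegral_image_eq_lintegral_deriv_mul_of_monotoneOn measurableSet_Ioi
    (fun r _ => (hasDerivAt_rho r).hasDerivWithinAt) monotoneOn_rho u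

/-! ### Radial profiles and the radial contraction `x ↦ x / √(1 + ‖x‖²)` -/

/-- The profile `(1 + r²)^{-d}`. [folklore] -/
noncomputable def cauchyProfile (d : ℕ) (r : ℝ) : ℝ := ((1 + r ^ 2) ^ d)⁻¹

/-- The profile `(1 − t²)^{e−1} 𝟙[t < 1]`. [folklore] -/
noncomputable def ballProfile (e : ℕ) (t : ℝ) : ℝ := if t < 1 then (1 - t ^ 2) ^ (e - 1) else 0

/-- `(1+r²)^{-d} ≥ 0`. [folklore] -/
theorem cauchyProfile_nonneg (d : ℕ) (r : ℝ) : 0 ≤ cauchyProfile d r := by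
  unfold cauchyProfile; positivity

/-- The ball profile is nonnegative on `[0,∞)`. [folklore] -/
theorem ballProfile_nonneg (e : ℕ) {t : ℝ} (ht : 0 ≤ t) : 0 ≤ ballProfile e t := by
  unfold ballProfile
  split_ifs with h
  · exact pow_nonneg (by nlinarith) _
  · exact le_rfl

/-- The ball profile vanishes on `[1,∞)`. [folklore] -/
theorem ballProfile_of_one_le (e : ℕ) {t : ℝ} (ht : 1 ≤ t) : ballProfile e t = 0 := by
  unfold ballProfile; rw [if_neg (not_lt.2 ht)]

/-- Measurability of the profile `(1+r²)^{-d}`. [folklore] -/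
theorem measurable_cauchyProfile (d : ℕ) : Measurable (cauchyProfile d) := by
  unfold cauchyProfile; fun_prop

/-- Measurability of the ball profile. [folklore] -/
theorem measurable_ballProfile (e : ℕ) : Measurable (ballProfile e) := by
  unfold ballProfile
  refine Measurable.ite measurableSet_Iio (by fun_prop) measurable_const

/-- `ρ' > 0`. [folklore] -/
theorem rho'_pos (r : ℝ) : 0 < rho' r := by
  unfold rho'; exact pow_pos (inv_pos.2 (sqrt_one_add_sq_pos r)) 3

/-- **The scalar identity behind the substitution**: for `r > 0`, `e ≥ 1`,
`ρ'(r) ρ(r)^{2n−1} (1 − ρ(r)²)^{e−1} = r^{2n−1} (1 + r²)^{−(n+e)}`. [folklore] -/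
theorem rho'_mul_pow_mul_ballProfile (n e : ℕ) (hn : 1 ≤ n) (he : 1 ≤ e) (r : ℝ) :
    rho' r * (rho r ^ (2 * n - 1) * ballProfile e (rho r)) =
      r ^ (2 * n - 1) * cauchyProfile (n + e) r := by
  set q := Real.sqrt (1 + r ^ 2) with hq
  have hq0 : 0 < q := sqrt_one_add_sq_pos r
  have hq2 : q ^ 2 = 1 + r ^ 2 := Real.sq_sqrt (by positivity : (0 : ℝ) < 1 + r ^ 2).le
  have hball : ballProfile e (rho r) = ((q ^ 2)⁻¹) ^ (e - 1) := by
    rw [ballProfile, if_pos (rho_lt_one r), one_sub_rho_sq, hq2]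
  have hrho : rho r = r * q⁻¹ := by rw [rho, div_eq_mul_inv]
  have hrho' : rho' r = (q⁻¹) ^ 3 := rfl
  have hc : cauchyProfile (n + e) r = (q⁻¹) ^ (2 * (n + e)) := by
    rw [cauchyProfile, ← hq2, ← pow_mul, inv_pow]
  rw [hball, hrho, hrho', hc]
  have hexp : 3 + (2 * n - 1) + 2 * (e - 1) = 2 * (n + e) := by omega
  rw [← hexp, pow_add, pow_add, mul_pow, ← inv_pow, ← pow_mul]
  ring

section Radial

variable {E : Type*} [NormedAddCommGroup E] [NormedSpace ℝ E] [MeasurableSpace E] [BorelSpace E]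
  [FiniteDimensional ℝ E] [Nontrivial E] (μ : Measure E) [μ.IsAddHaarMeasure]

omit [MeasurableSpace E] [BorelSpace E] [FiniteDimensional ℝ E] [Nontrivial E] in
/-- The radial contraction `ψ(x) = x / √(1 + ‖x‖²)` of `E` onto its open unit ball is Mathlib's
`OpenPartialHomeomorph.univUnitBall`; on the ray through `θ ∈ S` it acts by `ψ(rθ) = ρ(r)θ`.
[folklore] -/
theorem univUnitBall_smul_sphere (θ : sphere (0 : E) 1) {r : ℝ} (hr : 0 < r) :
    OpenPartialHomeomorph.univUnitBall (r • (θ : E)) = rho r • (θ : E) := by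
  have hθ : ‖(θ : E)‖ = 1 := by simp
  rw [OpenPartialHomeomorph.univUnitBall_apply, norm_smul, hθ, mul_one, Real.norm_of_nonneg hr.le,
    smul_smul, rho, div_eq_inv_mul]

omit [FiniteDimensional ℝ E] [Nontrivial E] in
/-- `ψ = univUnitBall` is measurable (it is continuous). [folklore] -/
theorem measurable_univUnitBall : Measurable (OpenPartialHomeomorph.univUnitBall : E → E) := by
  have : (OpenPartialHomeomorph.univUnitBall : E → E) = fun x => (Real.sqrt (1 + ‖x‖ ^ 2))⁻¹ • x :=
    funext fun x => OpenPartialHomeomorph.univUnitBall_apply x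
  rw [this]
  exact ((measurable_norm.pow_const 2).const_add 1).sqrt.inv.smul measurable_id

/-- **The radial substitution on `E`.** If `dim E = 2n`, `n, e ≥ 1`, then for every measurable
`s ⊆ E`: `∫ 𝟙_s(ψ x) (1 + ‖x‖²)^{−(n+e)} dμ = ∫ 𝟙_s(x) (1 − ‖x‖²)^{e−1} 𝟙[‖x‖ < 1] dμ`
(`ψ = univUnitBall`; polar coordinates and the substitution `t = r/√(1+r²)` in the radial integral),
i.e. the radial contraction pushes the measure `(1 + ‖x‖²)^{−(n+e)} dμ` forward to
`(1 − ‖x‖²)_+^{e−1} dμ`. [folklore] -/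
theorem lintegral_indicator_univUnitBall (n e : ℕ) (hn : 1 ≤ n) (he : 1 ≤ e)
    (hE : Module.finrank ℝ E = 2 * n) {s : Set E} (hs : MeasurableSet s) :
    ∫⁻ x, s.indicator 1 (OpenPartialHomeomorph.univUnitBall x) *
        ENNReal.ofReal (cauchyProfile (n + e) ‖x‖) ∂μ =
      ∫⁻ x, s.indicator 1 x * ENNReal.ofReal (ballProfile e ‖x‖) ∂μ := by
  have hind : Measurable (s.indicator (1 : E → ℝ≥0∞)) := measurable_one.indicator hs
  have hmL : Measurable fun x : E => s.indicator 1 (OpenPartialHomeomorph.univUnitBall x) *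
      ENNReal.ofReal (cauchyProfile (n + e) ‖x‖) :=
    (hind.comp measurable_univUnitBall).mul
      (ENNReal.measurable_ofReal.comp ((measurable_cauchyProfile _).comp measurable_norm))
  have hmR : Measurable fun x : E => s.indicator 1 x * ENNReal.ofReal (ballProfile e ‖x‖) :=
    hind.mul (ENNReal.measurable_ofReal.comp ((measurable_ballProfile _).comp measurable_norm))
  rw [lintegral_eq_lintegral_sphere_lintegral_Ioi μ _ hmL,
    lintegral_eq_lintegral_sphere_lintegral_Ioi μ _ hmR, hE]
  refine lintegral_congr fun θ => ?_
  have hθ : ‖(θ : E)‖ = 1 := by simp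
  have hnorm : ∀ r : ℝ, 0 < r → ‖r • (θ : E)‖ = r := fun r hr => by
    rw [norm_smul, hθ, mul_one, Real.norm_of_nonneg hr.le]
  -- the right-hand radial integrand
  set u : ℝ → ℝ≥0∞ := fun t => ENNReal.ofReal (t ^ (2 * n - 1)) *
    (s.indicator 1 (t • (θ : E)) * ENNReal.ofReal (ballProfile e t)) with hu
  have hR : ∫⁻ t in Ioi (0 : ℝ), ENNReal.ofReal (t ^ (2 * n - 1)) *
      (s.indicator 1 (t • (θ : E)) * ENNReal.ofReal (ballProfile e ‖t • (θ : E)‖)) =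
      ∫⁻ t in Ioo (0 : ℝ) 1, u t := by
    have h1 : ∫⁻ t in Ioi (0 : ℝ), ENNReal.ofReal (t ^ (2 * n - 1)) *
        (s.indicator 1 (t • (θ : E)) * ENNReal.ofReal (ballProfile e ‖t • (θ : E)‖)) =
        ∫⁻ t in Ioi (0 : ℝ), (Iio (1 : ℝ)).indicator u t := by
      refine setLIntegral_congr_fun measurableSet_Ioi fun t ht => ?_
      rw [hnorm t ht]
      by_cases h1 : t < 1
      · rw [indicator_of_mem (show t ∈ Iio (1 : ℝ) from h1)]
      · rw [indicator_of_notMem (show t ∉ Iio (1 : ℝ) from h1)]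
        simp only [ballProfile_of_one_le e (not_lt.1 h1), ENNReal.ofReal_zero, mul_zero]
    rw [h1, lintegral_indicator measurableSet_Iio, Measure.restrict_restrict measurableSet_Iio,
      Iio_inter_Ioi]
  -- the left-hand radial integrand
  have hL : ∫⁻ r in Ioi (0 : ℝ), ENNReal.ofReal (r ^ (2 * n - 1)) *
      (s.indicator 1 (OpenPartialHomeomorph.univUnitBall (r • (θ : E))) *
        ENNReal.ofReal (cauchyProfile (n + e) ‖r • (θ : E)‖)) =
      ∫⁻ r in Ioi (0 : ℝ), ENNReal.ofReal (rho' r) * u (rho r) := by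
    refine setLIntegral_congr_fun measurableSet_Ioi fun r hr => ?_
    have hr : 0 < r := hr
    rw [hnorm r hr, univUnitBall_smul_sphere θ hr, hu]
    dsimp only
    have e1 : ENNReal.ofReal (r ^ (2 * n - 1)) * (s.indicator 1 (rho r • (θ : E)) *
        ENNReal.ofReal (cauchyProfile (n + e) r)) =
        s.indicator 1 (rho r • (θ : E)) * ENNReal.ofReal (r ^ (2 * n - 1) * cauchyProfile (n + e) r) := by
      rw [ENNReal.ofReal_mul (pow_nonneg hr.le _)]; ring
    have e2 : ENNReal.ofReal (rho' r) * (ENNReal.ofReal (rho r ^ (2 * n - 1)) *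
        (s.indicator 1 (rho r • (θ : E)) * ENNReal.ofReal (ballProfile e (rho r)))) =
        s.indicator 1 (rho r • (θ : E)) *
          ENNReal.ofReal (rho' r * (rho r ^ (2 * n - 1) * ballProfile e (rho r))) := by
      rw [ENNReal.ofReal_mul (rho'_pos r).le,
        ENNReal.ofReal_mul (pow_nonneg (rho_pos hr).le _)]
      ring
    rw [e1, e2, rho'_mul_pow_mul_ballProfile n e hn he r]
  rw [hL, hR, lintegral_Ioo_eq_lintegral_Ioi_rho]

end Radial

/-! ### Squared Euclidean norm on `ι → ℂ` and the density of `γ^ι` -/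

section Nsq

open Literature.Computability.QuantumComplexity (stdComplexGaussian stdComplexGaussianDensity
  stdComplexGaussian_eq_withDensity continuous_stdComplexGaussianDensity
  sigmaFinite_withDensity_stdComplexGaussianDensity)

variable {ι : Type*} [Fintype ι]

/-- The squared Euclidean norm `∑ᵢ |vᵢ|²` of `v : ι → ℂ`, for an arbitrary finite index type `ι`
(the linear-image law of `ProjectedSphereDensity` is applied with `ι = Fin n ⊕ Fin e` and with
coefficient types that are not literally `Fin _`). On `Fin n → ℂ` this is *definitionally* the
`vecNormSq` of `UnitaryInvariantPolar` (`nsq_eq_vecNormSq`), whose API should be preferred there.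
[folklore] -/
noncomputable def nsq (v : ι → ℂ) : ℝ := ∑ i, ‖v i‖ ^ 2

omit [Fintype ι] in
/-- On `Fin n → ℂ`, `nsq` is the `vecNormSq` of `UnitaryInvariantPolar`. [folklore] -/
theorem nsq_eq_vecNormSq {n : ℕ} (v : Fin n → ℂ) : nsq v = vecNormSq v := rfl

/-- `∑|vᵢ|² ≥ 0`. [folklore] -/
theorem nsq_nonneg (v : ι → ℂ) : 0 ≤ nsq v :=
  Finset.sum_nonneg fun _ _ => sq_nonneg _

/-- `∑|(cv)ᵢ|² = c² ∑|vᵢ|²` for real `c`. [folklore] -/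
theorem nsq_smul (c : ℝ) (v : ι → ℂ) : nsq (c • v) = c ^ 2 * nsq v := by
  unfold nsq
  rw [Finset.mul_sum]
  refine Finset.sum_congr rfl fun i _ => ?_
  rw [Pi.smul_apply, norm_smul, mul_pow, Real.norm_eq_abs, sq_abs]

omit [Fintype ι] in
/-- `v ↦ ∑|vᵢ|²` is continuous. [folklore] -/
theorem continuous_nsq [Fintype ι] : Continuous (nsq (ι := ι)) := by
  unfold nsq; fun_prop

/-- `v ↦ ∑|vᵢ|²` is measurable. [folklore] -/
theorem measurable_nsq : Measurable (nsq (ι := ι)) := continuous_nsq.measurable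

/-- `∑|vᵢ|²` is the squared Euclidean norm. [folklore] -/
theorem nsq_ofLp (x : EuclideanSpace ℂ ι) : nsq (ofLp x) = ‖x‖ ^ 2 := by
  rw [EuclideanSpace.norm_sq_eq]; rfl

/-- `√(∑|vᵢ|²)` is the Euclidean norm. [folklore] -/
theorem sqrt_nsq_ofLp (x : EuclideanSpace ℂ ι) : Real.sqrt (nsq (ofLp x)) = ‖x‖ := by
  rw [nsq_ofLp, Real.sqrt_sq (norm_nonneg _)]

/-- `∑|vᵢ|² = 0 ↔ v = 0`. [folklore] -/
theorem nsq_eq_zero_iff (v : ι → ℂ) : nsq v = 0 ↔ v = 0 := by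
  constructor
  · intro h
    have h' := (Finset.sum_eq_zero_iff_of_nonneg fun j _ => sq_nonneg ‖v j‖).1 h
    funext i
    have := h' i (Finset.mem_univ i)
    simpa using this
  · rintro rfl; simp [nsq]

/-- The density `π^{-|ι|} e^{−∑|vᵢ|²}` of `γ^ι`. [folklore] -/
noncomputable def gaussianPiDensity (v : ι → ℂ) : ℝ := (π ^ Fintype.card ι)⁻¹ * Real.exp (-nsq v)

/-- The Gaussian density is positive. [folklore] -/
theorem gaussianPiDensity_pos (v : ι → ℂ) : 0 < gaussianPiDensity v := by
  unfold gaussianPiDensity; positivity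

/-- The Gaussian density is measurable. [folklore] -/
theorem measurable_gaussianPiDensity : Measurable (gaussianPiDensity (ι := ι)) := by
  unfold gaussianPiDensity
  exact measurable_const.mul (Real.measurable_exp.comp measurable_nsq.neg)

/-- The product of the coordinate densities `π⁻¹e^{−|vᵢ|²}` is `π^{-|ι|} e^{−∑|vᵢ|²}`. [folklore] -/
theorem prod_stdComplexGaussianDensity (v : ι → ℂ) :
    ∏ i, stdComplexGaussianDensity (v i) = gaussianPiDensity v := by
  simp only [stdComplexGaussianDensity, gaussianPiDensity, nsq]
  rw [Finset.prod_mul_distrib, Finset.prod_const, Finset.card_univ, ← Real.exp_sum,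
    ← Finset.sum_neg_distrib, inv_pow]

/-- **`γ^ι` has density `π^{-|ι|} e^{−∑|vᵢ|²}`** with respect to Lebesgue measure on `ι → ℂ`.
[folklore] -/
theorem gaussianPi_eq_withDensity (ι : Type*) [Fintype ι] :
    gaussianPi ι = volume.withDensity fun v => ENNReal.ofReal (gaussianPiDensity v) := by
  have hg : Measurable fun z : ℂ => ENNReal.ofReal (stdComplexGaussianDensity z) :=
    ENNReal.measurable_ofReal.comp continuous_stdComplexGaussianDensity.measurable
  rw [gaussianPi, stdComplexGaussian_eq_withDensity, MeasureTheory.volume_pi]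
  rw [Literature.MathematicalPhysics.KineticTheory.pi_withDensity_eq (fun _ => volume) (fun _ => hg)
    (fun _ => sigmaFinite_withDensity_stdComplexGaussianDensity)]
  congr 1
  funext v
  rw [← prod_stdComplexGaussianDensity, ENNReal.ofReal_prod_of_nonneg fun i _ =>
    (Literature.Computability.QuantumComplexity.stdComplexGaussianDensity_pos _).le]

/-- Lebesgue measure on `ι → ℂ` is `2|ι|`-dimensional. [folklore] -/
theorem finrank_real_pi_complex : Module.finrank ℝ (ι → ℂ) = 2 * Fintype.card ι := by
  rw [Module.finrank_pi_fintype, Finset.sum_const, Finset.card_univ, Complex.finrank_real_complex,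
    smul_eq_mul, mul_comm]

/-- **Linear rescaling of Lebesgue integrals on `ι → ℂ`**: for `r > 0`,
`∫ K(z) dz = r^{2|ι|} ∫ K(r v) dv`. [folklore] -/
theorem lintegral_eq_pow_mul_lintegral_smul (K : (ι → ℂ) → ℝ≥0∞) (hK : Measurable K) {r : ℝ}
    (hr : 0 < r) :
    ∫⁻ z, K z ∂volume = ENNReal.ofReal (r ^ (2 * Fintype.card ι)) * ∫⁻ v, K (r • v) ∂volume := by
  have h := Measure.map_addHaar_smul (volume : Measure (ι → ℂ)) hr.ne'
  rw [finrank_real_pi_complex] at h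
  have h2 : ∫⁻ v, K (r • v) ∂volume = ∫⁻ z, K z ∂(Measure.map (fun v : ι → ℂ => r • v) volume) :=
    (lintegral_map hK (measurable_const_smul r)).symm
  rw [h2, h, lintegral_smul_measure, smul_eq_mul, ← mul_assoc, ← ENNReal.ofReal_mul (by positivity),
    abs_of_pos (by positivity), mul_inv_cancel₀ (by positivity), ENNReal.ofReal_one, one_mul]

end Nsq

/-! ### The first `n` coordinates of a normalised Gaussian vector -/

section SphereHead

variable (n e : ℕ)

/-- The map `(z, y) ↦ z / √(|z|² + |y|²)`: the `z`-block of the unit vector `(z,y)/‖(z,y)‖`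
(value `0` at the origin). [folklore] -/
noncomputable def sphereHead (p : (Fin n → ℂ) × (Fin e → ℂ)) : Fin n → ℂ :=
  (Real.sqrt (nsq p.1 + nsq p.2))⁻¹ • p.1

/-- The contraction `v ↦ v / √(1 + |v|²)` of `ℂⁿ` onto its open unit ball. [folklore] -/
noncomputable def headContraction (v : Fin n → ℂ) : Fin n → ℂ := (Real.sqrt (1 + nsq v))⁻¹ • v

/-- The profile `(1 − |w|²)^{e−1} 𝟙[|w|² < 1]` of the law of `sphereHead`. [folklore] -/
noncomputable def headProfile (w : Fin n → ℂ) : ℝ := if nsq w < 1 then (1 - nsq w) ^ (e - 1) else 0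

/-- `sphereHead` is measurable. [folklore] -/
theorem measurable_sphereHead : Measurable (sphereHead n e) := by
  unfold sphereHead
  exact ((measurable_nsq.comp measurable_fst).add
    (measurable_nsq.comp measurable_snd)).sqrt.inv.smul measurable_fst

/-- `headContraction` is measurable. [folklore] -/
theorem measurable_headContraction : Measurable (headContraction n) := by
  unfold headContraction
  exact (measurable_nsq.const_add 1).sqrt.inv.smul measurable_id

/-- The head profile is the ball profile of the Euclidean norm. [folklore] -/
theorem headProfile_eq_ballProfile (w : Fin n → ℂ) :
    headProfile n e w = ballProfile e (Real.sqrt (nsq w)) := by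
  simp only [headProfile, ballProfile, Real.sq_sqrt (nsq_nonneg w), Real.sqrt_lt' one_pos, one_pow]

/-- The head profile is nonnegative. [folklore] -/
theorem headProfile_nonneg (w : Fin n → ℂ) : 0 ≤ headProfile n e w := by
  rw [headProfile_eq_ballProfile]; exact ballProfile_nonneg e (Real.sqrt_nonneg _)

/-- The head profile is measurable. [folklore] -/
theorem measurable_headProfile : Measurable (headProfile n e) := by
  have : headProfile n e = fun w => ballProfile e (Real.sqrt (nsq w)) :=
    funext (headProfile_eq_ballProfile n e)
  rw [this]
  exact (measurable_ballProfile e).comp measurable_nsq.sqrt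

/-- Scaling out `|y|`: for `|y| = r > 0`, `sphereHead (r v, y) = v / √(1 + |v|²)`. [folklore] -/
theorem sphereHead_smul {r : ℝ} (hr : 0 < r) (v : Fin n → ℂ) (y : Fin e → ℂ)
    (hy : nsq y = r ^ 2) : sphereHead n e (r • v, y) = headContraction n v := by
  rw [sphereHead, headContraction]
  dsimp only
  rw [nsq_smul, hy, ← mul_add_one, Real.sqrt_mul (sq_nonneg r), Real.sqrt_sq hr.le, smul_smul,
    add_comm (nsq v) 1]
  congr 1
  field_simp

/-- `headContraction` is the radial contraction `univUnitBall` of `EuclideanSpace ℂ (Fin n)` read in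
coordinates. [folklore] -/
theorem headContraction_ofLp (x : EuclideanSpace ℂ (Fin n)) :
    headContraction n (ofLp x) = ofLp (OpenPartialHomeomorph.univUnitBall x) := by
  rw [headContraction, OpenPartialHomeomorph.univUnitBall_apply, WithLp.ofLp_smul, nsq_ofLp]

/-- Indicators along a map: `𝟙_s(f a) = 𝟙_{f⁻¹ s}(a)` (Mathlib's `Set.indicator_comp_right` with
`g = 1`, in the form used for the `ℝ≥0∞`-valued integrands below). [folklore] -/
theorem indicator_one_comp {α β : Type*} (f : α → β) (s : Set β) (a : α) :
    s.indicator (1 : β → ℝ≥0∞) (f a) = (f ⁻¹' s).indicator 1 a := by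
  rw [← Set.indicator_comp_right, Pi.one_comp]

/-- `𝟙_s(a) · D(a) = (𝟙_s D)(a)` (Mathlib's `Set.indicator_mul_left` with `f = 1`). [folklore] -/
theorem indicator_one_mul {α : Type*} (s : Set α) (D : α → ℝ≥0∞) (a : α) :
    s.indicator 1 a * D a = s.indicator D a := by
  rw [← Set.indicator_mul_left s 1 D]
  simp only [Pi.one_apply, one_mul]

/-- **Step 1 (scaling out `|y|`).** For `y ≠ 0`, the `z`-integral of `𝟙_s(sphereHead(z,y))`
against `γⁿ` equals `|y|^{2n} π^{-n} ∫ e^{−|y|²|v|²} 𝟙_s(v/√(1+|v|²)) dv` (substitute `z = |y| v`).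
[folklore] -/
theorem lintegral_indicator_sphereHead {s : Set (Fin n → ℂ)} (hs : MeasurableSet s)
    {y : Fin e → ℂ} (hy : y ≠ 0) :
    ∫⁻ z, s.indicator 1 (sphereHead n e (z, y)) ∂(gaussianPi (Fin n)) =
      ENNReal.ofReal (nsq y ^ n) * ∫⁻ v, ENNReal.ofReal ((π ^ n)⁻¹ * Real.exp (-(nsq y * nsq v))) *
        s.indicator 1 (headContraction n v) ∂volume := by
  have hind : Measurable (s.indicator (1 : (Fin n → ℂ) → ℝ≥0∞)) := measurable_one.indicator hs
  have hfy : Measurable fun z : Fin n → ℂ => sphereHead n e (z, y) :=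
    (measurable_sphereHead n e).comp (measurable_id.prodMk measurable_const)
  have hdens : Measurable fun z : Fin n → ℂ => ENNReal.ofReal (gaussianPiDensity z) :=
    ENNReal.measurable_ofReal.comp measurable_gaussianPiDensity
  have hg : Measurable fun z : Fin n → ℂ => s.indicator 1 (sphereHead n e (z, y)) := hind.comp hfy
  rw [gaussianPi_eq_withDensity, lintegral_withDensity_eq_lintegral_mul _ hdens hg]
  simp only [Pi.mul_apply]
  have hpos : 0 < nsq y := lt_of_le_of_ne (nsq_nonneg y) (fun h => hy ((nsq_eq_zero_iff y).1 h.symm))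
  set r := Real.sqrt (nsq y) with hr
  have hr0 : 0 < r := Real.sqrt_pos.2 hpos
  have hr2 : r ^ 2 = nsq y := Real.sq_sqrt hpos.le
  have hK : Measurable fun z : Fin n → ℂ =>
      ENNReal.ofReal (gaussianPiDensity z) * s.indicator 1 (sphereHead n e (z, y)) :=
    hdens.mul hg
  rw [lintegral_eq_pow_mul_lintegral_smul _ hK hr0, Fintype.card_fin, pow_mul, hr2]
  congr 1
  refine lintegral_congr fun v => ?_
  rw [sphereHead_smul n e hr0 v y hr2.symm, gaussianPiDensity, nsq_smul, hr2, Fintype.card_fin]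

/-- The Gaussian moment constant `K₀ = ∫ |u|^{2n} e^{−|u|²} du` over `ℂᵉ`. [folklore] -/
noncomputable def momentConst : ℝ≥0∞ :=
  ∫⁻ u : Fin e → ℂ, ENNReal.ofReal (nsq u ^ n * Real.exp (-nsq u)) ∂volume

/-- **Step 2 (scaling out `√(1+|v|²)`).** For `t ≥ 0`,
`∫ |y|^{2n} e^{−|y|²(1+t)} dy = (1+t)^{−(n+e)} K₀` (substitute `y = u/√(1+t)`). [folklore] -/
theorem lintegral_moment_scaled {t : ℝ} (ht : 0 ≤ t) :
    ∫⁻ y : Fin e → ℂ, ENNReal.ofReal (nsq y ^ n * Real.exp (-(nsq y * (1 + t)))) ∂volume =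
      ENNReal.ofReal (((1 + t) ^ (n + e))⁻¹) * momentConst n e := by
  have h1t : 0 < 1 + t := by linarith
  set a := (Real.sqrt (1 + t))⁻¹ with ha
  have ha0 : 0 < a := inv_pos.2 (Real.sqrt_pos.2 h1t)
  have ha2 : a ^ 2 = (1 + t)⁻¹ := by rw [ha, inv_pow, Real.sq_sqrt h1t.le]
  have hL : Measurable fun y : Fin e → ℂ =>
      ENNReal.ofReal (nsq y ^ n * Real.exp (-(nsq y * (1 + t)))) :=
    ENNReal.measurable_ofReal.comp ((measurable_nsq.pow_const n).mul
      (Real.measurable_exp.comp (measurable_nsq.mul_const _).neg))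
  rw [lintegral_eq_pow_mul_lintegral_smul _ hL ha0, Fintype.card_fin, momentConst]
  have hK : Measurable fun u : Fin e → ℂ => ENNReal.ofReal (nsq u ^ n * Real.exp (-nsq u)) :=
    ENNReal.measurable_ofReal.comp ((measurable_nsq.pow_const n).mul
      (Real.measurable_exp.comp measurable_nsq.neg))
  have hpt : ∀ u : Fin e → ℂ, ENNReal.ofReal (nsq (a • u) ^ n * Real.exp (-(nsq (a • u) * (1 + t)))) =
      ENNReal.ofReal (a ^ (2 * n)) * ENNReal.ofReal (nsq u ^ n * Real.exp (-nsq u)) := by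
    intro u
    have e1 : nsq (a • u) * (1 + t) = nsq u := by
      rw [nsq_smul, ha2, mul_comm, ← mul_assoc, mul_inv_cancel₀ h1t.ne', one_mul]
    rw [e1, nsq_smul, mul_pow, ← pow_mul, ← ENNReal.ofReal_mul (by positivity), mul_assoc]
  simp_rw [hpt]
  rw [lintegral_const_mul _ hK, ← mul_assoc, ← ENNReal.ofReal_mul (by positivity)]
  congr 2
  rw [pow_mul, pow_mul, ha2, ← pow_add, inv_pow, add_comm e n]

/-- **Step 3 (the radial step, on `ℂⁿ`).** For `n, e ≥ 1` and measurable `s ⊆ ℂⁿ`,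
`∫ 𝟙_s(v/√(1+|v|²)) (1+|v|²)^{−(n+e)} dv = ∫ 𝟙_s(v) (1 − |v|²)_+^{e−1} dv`
(`lintegral_indicator_univUnitBall` transported along `ℂⁿ ≃ EuclideanSpace ℂ (Fin n)`, whose
norm is the Euclidean one). [folklore] -/
theorem lintegral_indicator_headContraction (hn : 1 ≤ n) (he : 1 ≤ e) {s : Set (Fin n → ℂ)}
    (hs : MeasurableSet s) :
    ∫⁻ v, s.indicator 1 (headContraction n v) *
        ENNReal.ofReal (cauchyProfile (n + e) (Real.sqrt (nsq v))) ∂volume =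
      ∫⁻ v, s.indicator 1 v * ENNReal.ofReal (headProfile n e v) ∂volume := by
  haveI : Nonempty (Fin n) := ⟨⟨0, hn⟩⟩
  set μE : Measure (EuclideanSpace ℂ (Fin n)) :=
    Measure.map (toLp 2 : (Fin n → ℂ) → EuclideanSpace ℂ (Fin n)) volume with hμE
  haveI : μE.IsAddHaarMeasure :=
    ContinuousLinearEquiv.isAddHaarMeasure_map
      (PiLp.continuousLinearEquiv 2 ℝ (fun _ : Fin n => ℂ)).symm (volume : Measure (Fin n → ℂ))
  have hfin : Module.finrank ℝ (EuclideanSpace ℂ (Fin n)) = 2 * n := by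
    rw [(PiLp.continuousLinearEquiv 2 ℝ (fun _ : Fin n => ℂ)).toLinearEquiv.finrank_eq,
      finrank_real_pi_complex, Fintype.card_fin]
  have hmo : Measurable (ofLp : EuclideanSpace ℂ (Fin n) → Fin n → ℂ) := WithLp.measurable_ofLp 2 _
  have hmt : Measurable (toLp 2 : (Fin n → ℂ) → EuclideanSpace ℂ (Fin n)) :=
    WithLp.measurable_toLp 2 _
  have hvol : (volume : Measure (Fin n → ℂ)) = μE.map ofLp := by
    rw [hμE, Measure.map_map hmo hmt]
    exact Measure.map_id.symm
  have htr : ∀ Q : (Fin n → ℂ) → ℝ≥0∞, Measurable Q →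
      ∫⁻ v, Q v ∂volume = ∫⁻ x, Q (ofLp x) ∂μE := by
    intro Q hQ
    rw [hvol, lintegral_map hQ hmo]
  have hind : Measurable (s.indicator (1 : (Fin n → ℂ) → ℝ≥0∞)) := measurable_one.indicator hs
  have hQL : Measurable fun v : Fin n → ℂ => s.indicator 1 (headContraction n v) *
      ENNReal.ofReal (cauchyProfile (n + e) (Real.sqrt (nsq v))) :=
    (hind.comp (measurable_headContraction n)).mul (ENNReal.measurable_ofReal.comp
      ((measurable_cauchyProfile _).comp measurable_nsq.sqrt))
  have hQR : Measurable fun v : Fin n → ℂ => s.indicator 1 v * ENNReal.ofReal (headProfile n e v) :=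
    hind.mul (ENNReal.measurable_ofReal.comp (measurable_headProfile n e))
  rw [htr _ hQL, htr _ hQR]
  have hsE : MeasurableSet ((ofLp : EuclideanSpace ℂ (Fin n) → Fin n → ℂ) ⁻¹' s) := hmo hs
  have key := lintegral_indicator_univUnitBall μE n e hn he hfin hsE
  convert key using 1
  · refine lintegral_congr fun x => ?_
    rw [sqrt_nsq_ofLp, headContraction_ofLp, indicator_one_comp ofLp s]
  · refine lintegral_congr fun x => ?_
    rw [headProfile_eq_ballProfile, sqrt_nsq_ofLp, indicator_one_comp ofLp s]

/-- The normalising constant `C = π^{-(n+e)} K₀` of the law of `sphereHead`. [folklore] -/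
noncomputable def sphereHeadConst : ℝ≥0∞ := ENNReal.ofReal ((π ^ (n + e))⁻¹) * momentConst n e

/-- **The law of the first `n` coordinates of a uniform point on the unit sphere of `ℂ^{n+e}`
(density form).** For `n, e ≥ 1` and independent standard complex Gaussian vectors `z ∈ ℂⁿ`,
`y ∈ ℂᵉ` (so that `(z,y)/‖(z,y)‖` is uniformly distributed on the unit sphere `S^{2(n+e)−1}`), the
block `w = z/√(|z|²+|y|²) ∈ ℂⁿ` has the law `C (1 − |w|²)^{e−1} 𝟙[|w| < 1] dw` for the constant
`C = sphereHeadConst n e` (`= π^{-n}(n+e−1)!/(e−1)!`, not evaluated here). Proof: scale out `|y|`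
and `√(1+|v|²)` (Steps 1–2), then the radial substitution (Step 3). [folklore] -/
theorem map_sphereHead_gaussianPi_prod (hn : 1 ≤ n) (he : 1 ≤ e) :
    ((gaussianPi (Fin n)).prod (gaussianPi (Fin e))).map (sphereHead n e) =
      volume.withDensity (fun w => sphereHeadConst n e * ENNReal.ofReal (headProfile n e w)) := by
  haveI : Nonempty (Fin e) := ⟨⟨0, he⟩⟩
  have hf := measurable_sphereHead n e
  ext s hs
  have hind : Measurable (s.indicator (1 : (Fin n → ℂ) → ℝ≥0∞)) := measurable_one.indicator hs
  -- the left-hand side as an iterated integral, `y` outside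
  rw [Measure.map_apply hf hs, ← lintegral_indicator_one (hf hs)]
  have h1 : ∫⁻ p, (sphereHead n e ⁻¹' s).indicator 1 p ∂((gaussianPi (Fin n)).prod (gaussianPi (Fin e)))
      = ∫⁻ y, ∫⁻ z, s.indicator 1 (sphereHead n e (z, y)) ∂(gaussianPi (Fin n))
          ∂(gaussianPi (Fin e)) := by
    rw [lintegral_prod_symm _ (measurable_one.indicator (hf hs)).aemeasurable]
    refine lintegral_congr fun y => lintegral_congr fun z => ?_
    rw [indicator_one_comp (sphereHead n e) s]
  rw [h1]
  -- Step 1, for almost every `y`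
  have hG : Measurable fun q : (Fin e → ℂ) × (Fin n → ℂ) =>
      ENNReal.ofReal ((π ^ n)⁻¹ * Real.exp (-(nsq q.1 * nsq q.2))) *
        s.indicator 1 (headContraction n q.2) :=
    (ENNReal.measurable_ofReal.comp (measurable_const.mul (Real.measurable_exp.comp
      ((measurable_nsq.comp measurable_fst).mul (measurable_nsq.comp measurable_snd)).neg))).mul
      (hind.comp ((measurable_headContraction n).comp measurable_snd))
  obtain ⟨I, hI⟩ : ∃ I : (Fin e → ℂ) → ℝ≥0∞, I = fun y => ENNReal.ofReal (nsq y ^ n) *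
      ∫⁻ v, ENNReal.ofReal ((π ^ n)⁻¹ * Real.exp (-(nsq y * nsq v))) *
        s.indicator 1 (headContraction n v) ∂volume := ⟨_, rfl⟩
  have hIm : Measurable I := by
    rw [hI]
    exact (ENNReal.measurable_ofReal.comp (measurable_nsq.pow_const n)).mul hG.lintegral_prod_right'
  have h0 : (gaussianPi (Fin e)) {0} = 0 := by
    rw [gaussianPi_eq_withDensity]
    exact withDensity_absolutelyContinuous _ _ (measure_singleton _)
  have h2 : ∫⁻ y, ∫⁻ z, s.indicator 1 (sphereHead n e (z, y)) ∂(gaussianPi (Fin n))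
      ∂(gaussianPi (Fin e)) = ∫⁻ y, I y ∂(gaussianPi (Fin e)) := by
    refine lintegral_congr_ae ?_
    filter_upwards [compl_mem_ae_iff.2 h0] with y hy
    rw [hI]
    exact lintegral_indicator_sphereHead n e hs hy
  have hdens : Measurable fun v : Fin e → ℂ => ENNReal.ofReal (gaussianPiDensity v) :=
    ENNReal.measurable_ofReal.comp measurable_gaussianPiDensity
  rw [h2, gaussianPi_eq_withDensity, lintegral_withDensity_eq_lintegral_mul _ hdens hIm]
  simp only [Pi.mul_apply]
  -- Tonelli
  obtain ⟨Φ, hΦ⟩ : ∃ Φ : (Fin e → ℂ) → (Fin n → ℂ) → ℝ≥0∞, Φ = fun y v =>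
    ENNReal.ofReal (gaussianPiDensity y) * ENNReal.ofReal (nsq y ^ n) *
      (ENNReal.ofReal ((π ^ n)⁻¹ * Real.exp (-(nsq y * nsq v))) *
        s.indicator 1 (headContraction n v)) := ⟨_, rfl⟩
  have hΦm : Measurable (Function.uncurry Φ) := by
    rw [hΦ]
    exact (((ENNReal.measurable_ofReal.comp measurable_gaussianPiDensity).comp measurable_fst).mul
      ((ENNReal.measurable_ofReal.comp (measurable_nsq.pow_const n)).comp measurable_fst)).mul hG
  have h3 : ∀ y, ENNReal.ofReal (gaussianPiDensity y) * I y = ∫⁻ v, Φ y v ∂volume := by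
    intro y
    rw [hI, hΦ]
    dsimp only
    rw [← mul_assoc, ← lintegral_const_mul' _ _
      (ENNReal.mul_ne_top ENNReal.ofReal_ne_top ENNReal.ofReal_ne_top)]
  simp_rw [h3]
  rw [lintegral_lintegral_swap hΦm.aemeasurable]
  -- Step 2, for every `v`
  have h4 : ∀ v, ∫⁻ y, Φ y v ∂volume = s.indicator 1 (headContraction n v) *
      (sphereHeadConst n e * ENNReal.ofReal (cauchyProfile (n + e) (Real.sqrt (nsq v)))) := by
    intro v
    have hpt : ∀ y, Φ y v = s.indicator 1 (headContraction n v) * ENNReal.ofReal ((π ^ (n + e))⁻¹) *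
        ENNReal.ofReal (nsq y ^ n * Real.exp (-(nsq y * (1 + nsq v)))) := by
      intro y
      rw [hΦ]
      dsimp only
      have hnn : 0 ≤ nsq y ^ n := pow_nonneg (nsq_nonneg y) n
      have key : ENNReal.ofReal (gaussianPiDensity y) * ENNReal.ofReal (nsq y ^ n) *
          ENNReal.ofReal ((π ^ n)⁻¹ * Real.exp (-(nsq y * nsq v))) =
          ENNReal.ofReal ((π ^ (n + e))⁻¹) *
            ENNReal.ofReal (nsq y ^ n * Real.exp (-(nsq y * (1 + nsq v)))) := by
        rw [← ENNReal.ofReal_mul (gaussianPiDensity_pos y).le,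
          ← ENNReal.ofReal_mul (mul_nonneg (gaussianPiDensity_pos y).le hnn),
          ← ENNReal.ofReal_mul (by positivity), gaussianPiDensity, Fintype.card_fin]
        congr 1
        rw [pow_add, mul_inv, mul_add, mul_one, neg_add, Real.exp_add]; ring
      calc ENNReal.ofReal (gaussianPiDensity y) * ENNReal.ofReal (nsq y ^ n) *
            (ENNReal.ofReal ((π ^ n)⁻¹ * Real.exp (-(nsq y * nsq v))) *
              s.indicator 1 (headContraction n v))
          = ENNReal.ofReal (gaussianPiDensity y) * ENNReal.ofReal (nsq y ^ n) *
            ENNReal.ofReal ((π ^ n)⁻¹ * Real.exp (-(nsq y * nsq v))) *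
              s.indicator 1 (headContraction n v) := by ring
        _ = ENNReal.ofReal ((π ^ (n + e))⁻¹) *
            ENNReal.ofReal (nsq y ^ n * Real.exp (-(nsq y * (1 + nsq v)))) *
              s.indicator 1 (headContraction n v) := by rw [key]
        _ = _ := by ring
    simp_rw [hpt]
    have hm : Measurable fun y : Fin e → ℂ =>
        ENNReal.ofReal (nsq y ^ n * Real.exp (-(nsq y * (1 + nsq v)))) :=
      ENNReal.measurable_ofReal.comp ((measurable_nsq.pow_const n).mul
        (Real.measurable_exp.comp (measurable_nsq.mul_const _).neg))
    rw [lintegral_const_mul _ hm, lintegral_moment_scaled n e (nsq_nonneg v), sphereHeadConst,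
      cauchyProfile, Real.sq_sqrt (nsq_nonneg v)]
    ring
  simp_rw [h4]
  -- Step 3 and the right-hand side
  have hQ : Measurable fun v : Fin n → ℂ => s.indicator 1 (headContraction n v) *
      ENNReal.ofReal (cauchyProfile (n + e) (Real.sqrt (nsq v))) :=
    (hind.comp (measurable_headContraction n)).mul (ENNReal.measurable_ofReal.comp
      ((measurable_cauchyProfile _).comp measurable_nsq.sqrt))
  have h5 : ∫⁻ v, s.indicator 1 (headContraction n v) *
      (sphereHeadConst n e * ENNReal.ofReal (cauchyProfile (n + e) (Real.sqrt (nsq v)))) ∂volume =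
      sphereHeadConst n e * ∫⁻ v, s.indicator 1 (headContraction n v) *
        ENNReal.ofReal (cauchyProfile (n + e) (Real.sqrt (nsq v))) ∂volume := by
    rw [← lintegral_const_mul _ hQ]
    refine lintegral_congr fun v => ?_
    ring
  have hP : Measurable fun v : Fin n → ℂ => s.indicator 1 v * ENNReal.ofReal (headProfile n e v) :=
    hind.mul (ENNReal.measurable_ofReal.comp (measurable_headProfile n e))
  rw [h5, lintegral_indicator_headContraction n e hn he hs, withDensity_apply _ hs,
    ← lintegral_indicator hs, ← lintegral_const_mul _ hP]
  refine lintegral_congr fun v => ?_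
  rw [← indicator_one_mul s (fun a => sphereHeadConst n e * ENNReal.ofReal (headProfile n e a)) v]
  ring

/-- The constant is neither `0` nor `∞` (the law of `sphereHead` is a probability measure).
[folklore] -/
theorem sphereHeadConst_ne_zero_and_ne_top (hn : 1 ≤ n) (he : 1 ≤ e) :
    sphereHeadConst n e ≠ 0 ∧ sphereHeadConst n e ≠ ∞ := by
  have hf := measurable_sphereHead n e
  haveI : IsProbabilityMeasure (((gaussianPi (Fin n)).prod (gaussianPi (Fin e))).map
      (sphereHead n e)) := Measure.isProbabilityMeasure_map hf.aemeasurable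
  have h1 : (((gaussianPi (Fin n)).prod (gaussianPi (Fin e))).map (sphereHead n e)) univ = 1 :=
    measure_univ
  have hP : Measurable fun v : Fin n → ℂ => ENNReal.ofReal (headProfile n e v) :=
    ENNReal.measurable_ofReal.comp (measurable_headProfile n e)
  rw [map_sphereHead_gaussianPi_prod n e hn he, withDensity_apply _ MeasurableSet.univ,
    Measure.restrict_univ, lintegral_const_mul _ hP] at h1
  constructor
  · intro h0
    rw [h0, zero_mul] at h1
    exact zero_ne_one h1
  · intro htop
    rw [htop, ENNReal.top_mul'] at h1
    split_ifs at h1 with h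
    · exact zero_ne_one h1
    · exact ENNReal.top_ne_one h1

end SphereHead

end Literature.Probability.RandomMatrix
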